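import Mathlib
import Summits.Ventures.PercRepro2.HMFEdgeChord
import Summits.Ventures.PercRepro2.EdmD
import Summits.Ventures.PercRepro2.Chord

/-!
# The normalised chord across the edge `{a₃, o}`: the `o`-edge is deletable modulo two X-free rows
(blind cell PercRepro2, night-1 g18; NIGHT1-G18.md §1)

Let `f = {a₃, o}` have weight `q = p f`, `Z = P(Q)`, `D = P(PD)`, and write `p⁰ = p[f ↦ 0]`,
`p¹ = p[f ↦ 1]`.  The mean field factorises, `HMFc = (1 − q) · Φ_o` (`OEdge.HMFc_eq_factor_o`), and
its `X̂`-term is `−2 Z D X̂` with `X̂(q) = (1 − q) X̂⁰` (`XhatPin.Xhat_eq_pin`, `Coinc.Xhat_a3_eq_o`):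
in the NORMALISED functional `G = HMFc / (Z D)` the mean field enters LINEARLY in `q`.  Hence the
chord condition on `G` along the edge,
`Z⁰ D⁰ · Φ_o(p) ≥ Z D · HMFc(p⁰)`, is a statement about the pattern masses alone.  Cleared, it is
the quadratic `H(q) = q (1 − q) · τ₀ + q² · τ₁` with two `X̂`-free tangent coefficients
(`tangentZero` = `τ₀` at `q = 0`, `tangentOne` = `τ₁ = Z⁰ D⁰ · Φ_o(p¹) − Z¹ D¹ · HMFc(p⁰)` at
`q = 1`):

* **`chord_identity`**: `Z⁰ D⁰ · Φ_o(p) − Z D · HMFc(p⁰) = q (1 − q) · τ₀ + q² · τ₁` (a ring identity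
  after pinning the nine masses of `Φ_o` at `p`; the `X̂⁰`-terms cancel);
* **`tangentOne_eq`**: `τ₁` in its `X̂`-free form;
* **`HMFc_eq_zero_of_degenerate`**: `Z D = 0 → HMFc = 0`;
* **`HMF_of_o_edge_of_normChord`**: the chord condition and (HMF) without the edge give (HMF);
* **`HMF_of_o_edge_of_tangents`**: `0 ≤ τ₀ → 0 ≤ τ₁ → HMF (p[f ↦ 0]) → HMF p` — the `o`-edge is
  deletable for (HMF) modulo the two tangent rows (census-true: NIGHT1-G18.md §1);
* **`normChord_imp_PhiO_update_one_nonneg`**: the row `0 ≤ τ₁` alone gives (FO-o) =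
  `0 ≤ Φ_o(p¹)` from (HMF) without the edge.

Own code; standard axioms.
-/

namespace Summit.Ventures.PercRepro2

open UnionCluster CovForm

namespace OEdge

section NormChord

variable {V : Type*} {E : Type*} [Fintype E] [DecidableEq E] [Fintype V] [DecidableEq V]
  {R : Type*} [Field R] [LinearOrder R] [IsStrictOrderedRing R]

variable (p : E → R) (ends : E → Sym2 V) (o a₁ a₂ a₃ b : V) (f : E)

/-- **The tangent coefficient at `q = 1`**: `τ₁ = Z⁰ D⁰ · Φ_o(p¹) − Z¹ D¹ · HMFc(p⁰)`
(`X̂`-free: `tangentOne_eq`). -/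
noncomputable def tangentOne : R :=
  prob (Function.update p f 0) (avoidAll ends a₂ {a₁}) *
      prob (Function.update p f 0) (PDEvent ends a₁ a₂ a₃) *
      PhiO (Function.update p f 1) ends o a₁ a₂ a₃ b f -
    prob (Function.update p f 1) (avoidAll ends a₂ {a₁}) *
      prob (Function.update p f 1) (PDEvent ends a₁ a₂ a₃) *
      HMFc (Function.update p f 0) ends o a₁ a₂ a₃ b

/-- **The tangent coefficient at `q = 0`** (`X̂`-free by construction): with `δm = m¹ − m⁰`,
`W = M₂ + Δ_T`, `S₃ = E_Q[σ₃]`, `J⁰ = EQo⁰ − EQ3o⁰`, `K⁰ = marginC⁰`,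
`τ₀ = Z⁰ D⁰ · [2 D_o⁰ (δZ · W⁰ + Z⁰ · δW) − δgap · K⁰ − gap⁰ (D_o⁰ (δZ − δS₃) − δD · J⁰)]
  − (δZ · D⁰ + Z⁰ · δD) · (2 Z⁰ D_o⁰ W⁰ − gap⁰ K⁰)`. -/
noncomputable def tangentZero : R :=
  prob (Function.update p f 0) (avoidAll ends a₂ {a₁}) *
      prob (Function.update p f 0) (PDEvent ends a₁ a₂ a₃) *
      (2 * Do (Function.update p f 0) ends o a₁ a₂ a₃ *
          ((prob (Function.update p f 1) (avoidAll ends a₂ {a₁}) -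
              prob (Function.update p f 0) (avoidAll ends a₂ {a₁})) *
            (massM2 (Function.update p f 0) ends a₁ a₂ a₃ b +
              deltaT (Function.update p f 0) ends a₁ a₂ a₃ b) +
          prob (Function.update p f 0) (avoidAll ends a₂ {a₁}) *
            ((massM2 (Function.update p f 1) ends a₁ a₂ a₃ b +
                deltaT (Function.update p f 1) ends a₁ a₂ a₃ b) -
              (massM2 (Function.update p f 0) ends a₁ a₂ a₃ b +
                deltaT (Function.update p f 0) ends a₁ a₂ a₃ b))) -
        (gap (Function.update p f 1) ends a₁ a₂ b - gap (Function.update p f 0) ends a₁ a₂ b) *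
          marginC (Function.update p f 0) ends o a₁ a₂ a₃ -
        gap (Function.update p f 0) ends a₁ a₂ b *
          (Do (Function.update p f 0) ends o a₁ a₂ a₃ *
              ((prob (Function.update p f 1) (avoidAll ends a₂ {a₁}) -
                  prob (Function.update p f 0) (avoidAll ends a₂ {a₁})) -
                (EQ3 (Function.update p f 1) ends a₁ a₂ a₃ -
                  EQ3 (Function.update p f 0) ends a₁ a₂ a₃)) -
            (prob (Function.update p f 1) (PDEvent ends a₁ a₂ a₃) -
                prob (Function.update p f 0) (PDEvent ends a₁ a₂ a₃)) *
              (EQo (Function.update p f 0) ends o a₁ a₂ -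
                EQ3o (Function.update p f 0) ends o a₁ a₂ a₃))) -
    ((prob (Function.update p f 1) (avoidAll ends a₂ {a₁}) -
          prob (Function.update p f 0) (avoidAll ends a₂ {a₁})) *
        prob (Function.update p f 0) (PDEvent ends a₁ a₂ a₃) +
      prob (Function.update p f 0) (avoidAll ends a₂ {a₁}) *
        (prob (Function.update p f 1) (PDEvent ends a₁ a₂ a₃) -
          prob (Function.update p f 0) (PDEvent ends a₁ a₂ a₃))) *
      (2 * prob (Function.update p f 0) (avoidAll ends a₂ {a₁}) *
          Do (Function.update p f 0) ends o a₁ a₂ a₃ *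
          (massM2 (Function.update p f 0) ends a₁ a₂ a₃ b +
            deltaT (Function.update p f 0) ends a₁ a₂ a₃ b) -
        gap (Function.update p f 0) ends a₁ a₂ b * marginC (Function.update p f 0) ends o a₁ a₂ a₃)

omit [LinearOrder R] [IsStrictOrderedRing R] in
/-- **The chord identity**: for ANY edge `f`,
`Z⁰ D⁰ · Φ_o(p) − Z D · HMFc(p⁰) = q (1 − q) · τ₀ + q² · τ₁` (the `X̂⁰`-terms cancel). -/
theorem chord_identity :
    prob (Function.update p f 0) (avoidAll ends a₂ {a₁}) *
          prob (Function.update p f 0) (PDEvent ends a₁ a₂ a₃) * PhiO p ends o a₁ a₂ a₃ b f -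
        prob p (avoidAll ends a₂ {a₁}) * prob p (PDEvent ends a₁ a₂ a₃) *
          HMFc (Function.update p f 0) ends o a₁ a₂ a₃ b =
      p f * (1 - p f) * tangentZero p ends o a₁ a₂ a₃ b f +
        p f ^ 2 * tangentOne p ends o a₁ a₂ a₃ b f := by
  unfold tangentZero tangentOne PhiO HMFc CovForm.marginC CovForm.DEF CovForm.Do CovForm.EQo
    CovForm.EQ3 CovForm.EQ3o CovForm.gap massM2 deltaT
  simp only [Function.update_idem]
  rw [prob_eq_pin p (avoidAll ends a₂ {a₁}) f, prob_eq_pin p (PDEvent ends a₁ a₂ a₃) f,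
    prob_eq_pin p (PDEvent ends a₁ a₂ a₃ ∩ connEvent ends a₂ b) f,
    prob_eq_pin p (connEvent ends a₂ b ∩ TEvent ends a₁ a₂ a₃) f,
    prob_eq_pin p (connEvent ends a₁ b ∩ TEvent ends a₁ a₂ a₃) f,
    prob_eq_pin p (connEvent ends a₂ b) f, prob_eq_pin p (connEvent ends a₁ b) f,
    prob_eq_pin p (TEvent ends a₂ a₁ a₃) f, prob_eq_pin p (TEvent ends a₁ a₂ a₃) f]
  ring

omit [LinearOrder R] [IsStrictOrderedRing R] in
/-- `τ₁` in its `X̂`-free form: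
`Z⁰ D⁰ · [2 Z¹ D_o⁰ W¹ − gap¹ (D_o⁰ (Z¹ − S₃¹) − D¹ J⁰)] − Z¹ D¹ · [2 Z⁰ D_o⁰ W⁰ − gap⁰ K⁰]`. -/
theorem tangentOne_eq :
    tangentOne p ends o a₁ a₂ a₃ b f =
      prob (Function.update p f 0) (avoidAll ends a₂ {a₁}) *
          prob (Function.update p f 0) (PDEvent ends a₁ a₂ a₃) *
          (2 * prob (Function.update p f 1) (avoidAll ends a₂ {a₁}) *
              Do (Function.update p f 0) ends o a₁ a₂ a₃ *
              (massM2 (Function.update p f 1) ends a₁ a₂ a₃ b +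
                deltaT (Function.update p f 1) ends a₁ a₂ a₃ b) -
            gap (Function.update p f 1) ends a₁ a₂ b *
              (Do (Function.update p f 0) ends o a₁ a₂ a₃ *
                  (prob (Function.update p f 1) (avoidAll ends a₂ {a₁}) -
                    EQ3 (Function.update p f 1) ends a₁ a₂ a₃) -
                prob (Function.update p f 1) (PDEvent ends a₁ a₂ a₃) *
                  (EQo (Function.update p f 0) ends o a₁ a₂ -
                    EQ3o (Function.update p f 0) ends o a₁ a₂ a₃))) -
        prob (Function.update p f 1) (avoidAll ends a₂ {a₁}) *
          prob (Function.update p f 1) (PDEvent ends a₁ a₂ a₃) *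
          (2 * prob (Function.update p f 0) (avoidAll ends a₂ {a₁}) *
              Do (Function.update p f 0) ends o a₁ a₂ a₃ *
              (massM2 (Function.update p f 0) ends a₁ a₂ a₃ b +
                deltaT (Function.update p f 0) ends a₁ a₂ a₃ b) -
            gap (Function.update p f 0) ends a₁ a₂ b *
              marginC (Function.update p f 0) ends o a₁ a₂ a₃) := by
  unfold tangentOne PhiO HMFc CovForm.marginC CovForm.DEF CovForm.Do CovForm.EQo CovForm.EQ3
    CovForm.EQ3o CovForm.gap massM2 deltaT
  simp only [Function.update_idem]
  ring

/-- `Z D = 0` kills the mean field. -/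
lemma HMFc_eq_zero_of_degenerate (hp : IsProbVec p)
    (h : prob p (avoidAll ends a₂ {a₁}) * prob p (PDEvent ends a₁ a₂ a₃) = 0) :
    HMFc p ends o a₁ a₂ a₃ b = 0 := by
  have hD : prob p (PDEvent ends a₁ a₂ a₃) = 0 := by
    rcases mul_eq_zero.1 h with hQ | hD
    · exact le_antisymm (hQ ▸ prob_mono hp (Chord.PDEvent_subset_avoidAll ends a₁ a₂ a₃))
        (prob_nonneg hp _)
    · exact hD
  have hDl : prob p (PDEvent ends a₁ a₂ a₃ ∩ connEvent ends a₁ o) = 0 :=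
    le_antisymm (hD ▸ prob_mono hp Set.inter_subset_left) (prob_nonneg hp _)
  have hDh : prob p (PDEvent ends a₁ a₂ a₃ ∩ connEvent ends a₂ o) = 0 :=
    le_antisymm (hD ▸ prob_mono hp Set.inter_subset_left) (prob_nonneg hp _)
  unfold HMFc CovForm.marginC CovForm.DEF CovForm.Do
  rw [hD, hDl, hDh]
  ring

/-- **(HMF) across the edge `{a₃, o}` from the normalised chord**: if
`Z D · HMFc(p⁰) ≤ Z⁰ D⁰ · Φ_o(p)` and (HMF) holds without the edge, (HMF) holds. -/
theorem HMF_of_o_edge_of_normChord (hp : IsProbVec p) (hf : ends f = s(a₃, o))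
    (hchord : prob p (avoidAll ends a₂ {a₁}) * prob p (PDEvent ends a₁ a₂ a₃) *
        HMFc (Function.update p f 0) ends o a₁ a₂ a₃ b ≤
      prob (Function.update p f 0) (avoidAll ends a₂ {a₁}) *
        prob (Function.update p f 0) (PDEvent ends a₁ a₂ a₃) * PhiO p ends o a₁ a₂ a₃ b f)
    (h0 : HMF (Function.update p f 0) ends o a₁ a₂ a₃ b) : HMF p ends o a₁ a₂ a₃ b := by
  have hp0 : IsProbVec (Function.update p f 0) := hp.update f le_rfl zero_le_one
  have hN0 : 0 ≤ prob (Function.update p f 0) (avoidAll ends a₂ {a₁}) *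
      prob (Function.update p f 0) (PDEvent ends a₁ a₂ a₃) :=
    mul_nonneg (prob_nonneg hp0 _) (prob_nonneg hp0 _)
  rcases hN0.lt_or_eq with hN0 | hN0
  · -- the non-degenerate case: the chord gives `0 ≤ Φ_o(p)`
    unfold HMF
    rw [HMFc_eq_factor_o p ends o b hf]
    unfold HMF at h0
    have hN : 0 ≤ prob p (avoidAll ends a₂ {a₁}) * prob p (PDEvent ends a₁ a₂ a₃) :=
      mul_nonneg (prob_nonneg hp _) (prob_nonneg hp _)
    have hΦ : 0 ≤ PhiO p ends o a₁ a₂ a₃ b f := by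
      have h1 : 0 ≤ prob (Function.update p f 0) (avoidAll ends a₂ {a₁}) *
          prob (Function.update p f 0) (PDEvent ends a₁ a₂ a₃) * PhiO p ends o a₁ a₂ a₃ b f :=
        le_trans (mul_nonneg hN h0) hchord
      exact (mul_nonneg_iff_of_pos_left hN0).1 h1
    exact mul_nonneg (by linarith [hp.le_one f]) hΦ
  · -- the degenerate case `Z⁰ D⁰ = 0`: then `Z D = 0` (both events are decreasing) and `HMFc = 0`
    have hZ0 : prob p (avoidAll ends a₂ {a₁}) ≤ prob (Function.update p f 0) (avoidAll ends a₂ {a₁}) :=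
      EdmRow.prob_le_prob_update_zero_of_isLowerSet hp (EdmRow.isLowerSet_avoidAll ends a₁ a₂) f
    have hD0 : prob p (PDEvent ends a₁ a₂ a₃) ≤ prob (Function.update p f 0) (PDEvent ends a₁ a₂ a₃) :=
      EdmRow.prob_le_prob_update_zero_of_isLowerSet hp (EdmRow.isLowerSet_PDEvent ends a₁ a₂ a₃) f
    have hN : prob p (avoidAll ends a₂ {a₁}) * prob p (PDEvent ends a₁ a₂ a₃) = 0 := by
      rcases mul_eq_zero.1 hN0.symm with hQ | hD
      · exact mul_eq_zero_of_left (le_antisymm (hQ ▸ hZ0) (prob_nonneg hp _)) _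
      · exact mul_eq_zero_of_right _ (le_antisymm (hD ▸ hD0) (prob_nonneg hp _))
    unfold HMF
    rw [HMFc_eq_zero_of_degenerate p ends o a₁ a₂ a₃ b hp hN]

/-- **The chord from its two tangent rows**: `0 ≤ τ₀`, `0 ≤ τ₁` give
`Z D · HMFc(p⁰) ≤ Z⁰ D⁰ · Φ_o(p)` for every weight `q = p f ∈ [0, 1]`. -/
theorem normChord_of_tangents (hp : IsProbVec p)
    (h0 : 0 ≤ tangentZero p ends o a₁ a₂ a₃ b f) (h1 : 0 ≤ tangentOne p ends o a₁ a₂ a₃ b f) :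
    prob p (avoidAll ends a₂ {a₁}) * prob p (PDEvent ends a₁ a₂ a₃) *
        HMFc (Function.update p f 0) ends o a₁ a₂ a₃ b ≤
      prob (Function.update p f 0) (avoidAll ends a₂ {a₁}) *
        prob (Function.update p f 0) (PDEvent ends a₁ a₂ a₃) * PhiO p ends o a₁ a₂ a₃ b f := by
  have hid := chord_identity p ends o a₁ a₂ a₃ b f
  have hq0 := hp.nonneg f
  have hq1 := hp.le_one f
  have h2 : 0 ≤ p f * (1 - p f) * tangentZero p ends o a₁ a₂ a₃ b f :=
    mul_nonneg (mul_nonneg hq0 (by linarith)) h0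
  have h3 : 0 ≤ p f ^ 2 * tangentOne p ends o a₁ a₂ a₃ b f := mul_nonneg (sq_nonneg _) h1
  linarith

/-- **The `o`-edge is deletable for (HMF) modulo the two tangent rows**:
`0 ≤ τ₀ → 0 ≤ τ₁ → HMF (p[f ↦ 0]) → HMF p` for `f = {a₃, o}`. -/
theorem HMF_of_o_edge_of_tangents (hp : IsProbVec p) (hf : ends f = s(a₃, o))
    (h0 : 0 ≤ tangentZero p ends o a₁ a₂ a₃ b f) (h1 : 0 ≤ tangentOne p ends o a₁ a₂ a₃ b f)
    (hHMF : HMF (Function.update p f 0) ends o a₁ a₂ a₃ b) : HMF p ends o a₁ a₂ a₃ b :=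
  HMF_of_o_edge_of_normChord p ends o a₁ a₂ a₃ b f hp hf
    (normChord_of_tangents p ends o a₁ a₂ a₃ b f hp h0 h1) hHMF

/-- **(FO-o) from the row `0 ≤ τ₁` and (HMF) without the edge**: `0 ≤ Φ_o(p¹)` whenever
`Z¹ D¹ > 0`... stated cleared: `Z⁰ D⁰ · Φ_o(p¹) ≥ Z¹ D¹ · HMFc(p⁰) ≥ 0`. -/
theorem PhiO_update_one_nonneg_of_tangentOne (hp : IsProbVec p)
    (h1 : 0 ≤ tangentOne p ends o a₁ a₂ a₃ b f)
    (hHMF : HMF (Function.update p f 0) ends o a₁ a₂ a₃ b)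
    (hN0 : 0 < prob (Function.update p f 0) (avoidAll ends a₂ {a₁}) *
      prob (Function.update p f 0) (PDEvent ends a₁ a₂ a₃)) :
    0 ≤ PhiO (Function.update p f 1) ends o a₁ a₂ a₃ b f := by
  have hp1 : IsProbVec (Function.update p f 1) := hp.update f zero_le_one le_rfl
  unfold tangentOne at h1
  unfold HMF at hHMF
  have hN1 : 0 ≤ prob (Function.update p f 1) (avoidAll ends a₂ {a₁}) *
      prob (Function.update p f 1) (PDEvent ends a₁ a₂ a₃) :=
    mul_nonneg (prob_nonneg hp1 _) (prob_nonneg hp1 _)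
  have h2 : 0 ≤ prob (Function.update p f 0) (avoidAll ends a₂ {a₁}) *
      prob (Function.update p f 0) (PDEvent ends a₁ a₂ a₃) *
      PhiO (Function.update p f 1) ends o a₁ a₂ a₃ b f := by
    have := mul_nonneg hN1 hHMF
    linarith
  exact (mul_nonneg_iff_of_pos_left hN0).1 h2

end NormChord

end OEdge

end Summit.Ventures.PercRepro2
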